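import Literature.NumberTheory.LFunctions.UniformWeilPositivityRH
import Literature.NumberTheory.LFunctions.WeilArchimedeanPositivityProofs
import Summits.RiemannHypothesis.RiemannHypothesis.Theorems.HandoffLatticeUncertainty
import HarnessLib

/-!
# The prolate domination conjecture (PL), typed, and `(PL) → RiemannHypothesis` (handoff idea-1 gen22; landed by prove-1 gen14)

TEXT OF RECORD: idea-1 g22's HOME file `handoff/idea-1/g22/lean/HandoffProlateDominationV2.lean`
(IDEAS-prolate §99–§100, §112, §119), landed verbatim except: (i) the out-of-band functional is the
tree's `LatticeUncertainty.leakage` (`HandoffLatticeUncertainty`, prove-1 gen14, ATTEMPT-21 — the SAME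
formula `∫_{|ξ| ≥ λ} |𝓕 f(ξ)|² dξ`), (ii) the peeling lemma lives in the companion file
`HandoffProlatePeeling` and is stated directly as `fibre_nonempty`.

This file TYPES the conjecture (PL) of IDEAS-prolate §100.2 over the tree's Weil vocabulary
(`IsWeilTest`, `weilQuadratic`, `WeilPositivityOn`) and kernel-checks the elementary implication
`(PL) → RiemannHypothesis` (§100.3 (a)). (PL) is an open conjecture (`@[conjecture] def … : Prop`),
used only as a hypothesis. Nothing here bears on the truth of RH.

Dictionary (CC 2023 = Connes–Consani, arXiv:2106.01715, §2–§3; tree = Bombieri's additive variable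
`t = log u`, window `[-a, a]` with `a = log λ`, so that exactly the primes `p ≤ e^{2a} = λ²` enter):
* `windowMap λ f` — the WINDOW PART `P_λ ℰ(f)` of the dilation sum `ℰ(f)(u) = u^{1/2} Σ_{n ≥ 1} f(nu)`
  (CC 2023 p. 3, (3.1) p. 11) at `u = e^t`: `e^{t/2} Σ_{1 ≤ n ≤ λ²} f(n e^t)`.
* `fibre λ g` — the smooth even `ℰ`-preimages of `g` time-limited to `[-λ, λ]` (IDEAS §99.3).
* `prolateLeakage λ g = L_λ(g) := inf {leakage λ f : f ∈ fibre λ g}` (IDEAS §100.1; a real `sInf`).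
* `ProlateDominationWith κ A λ₀` / `ProlateDomination` — (PL) (§100.2):
  `∃ κ > 0, A ≥ 0, λ₀ ≥ 1, ∀ λ ≥ λ₀, ∀ g (Weil test, tsupport g ⊆ [-log λ, log λ]),
   Re Q(g) ≥ κ · λ^{-A} · L_λ(g)`.
Results (elementary): `prolateLeakage_nonneg`; `weilPositivityOn_of_prolateDominationWith` — (PL) at
level `λ` gives the rung `WeilPositivityOn (log λ)`; `riemannHypothesis_of_prolateDomination` —
`(PL) → RiemannHypothesis`, through the tree's unconditional `riemannHypothesis_iff_forall_weilPositivityOn`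
(Weil/Yoshida criterion) and `WeilPositivityOn.mono`. RELATION TO THEOREM U0 (`HandoffLatticeUncertainty*`):
U0 shows that the FREE ratio `latticeTail/leakage` has infimum `0`; (PL) charges `prolateLeakage`, the
infimum of `leakage` over the fibre, and is untouched by U0 (ATTEMPT-21 §5, §7 (6)). What is NOT here:
any lower bound for `Re Q(g)`; `RH → (PL)` (unknown).
-/

set_option linter.dupNamespace false

noncomputable section

open scoped Real FourierTransform ContDiff Topology
open Complex MeasureTheory Set Filter Literature.NumberTheory.LFunctions

namespace Summit.RiemannHypothesis.RiemannHypothesis.Theorems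

namespace Prolate


/-- The window part `P_λ ℰ(f)` of the dilation sum, in the additive variable `t = log u`:
`(E_λ f)(t) = e^{t/2} Σ_{1 ≤ n ≤ ⌊λ²⌋} f(n e^t)` (CC 2023 (3.1); IDEAS-prolate §99.3). -/
def windowMap (lam : ℝ) (f : ℝ → ℂ) (t : ℝ) : ℂ :=
  (Real.exp (t / 2) : ℂ) * ∑ n ∈ Finset.Icc 1 ⌊lam ^ 2⌋₊, f ((n : ℝ) * Real.exp t)

/-- The fibre of smooth even `ℰ`-preimages of `g`, time-limited to `[-λ, λ]`, whose window part is
`g` on `[-log λ, log λ]` (IDEAS-prolate §99.3 / §100.1). -/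
def fibre (lam : ℝ) (g : ℝ → ℂ) : Set (ℝ → ℂ) :=
  {f | ContDiff ℝ ∞ f ∧ (∀ u, f (-u) = f u) ∧ tsupport f ⊆ Set.Icc (-lam) lam ∧
    EqOn g (windowMap lam f) (Set.Icc (-Real.log lam) (Real.log lam))}

/-- The PROLATE LEAKAGE `L_λ(g) = inf {leakage λ f : f ∈ fibre λ g}` (IDEAS-prolate §100.1). -/
def prolateLeakage (lam : ℝ) (g : ℝ → ℂ) : ℝ :=
  sInf (LatticeUncertainty.leakage lam '' fibre lam g)

/-- (PL) with explicit constants: for every `λ ≥ λ₀` and every Weil test `g` supported in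
`[-log λ, log λ]`, `Re Q(g) ≥ κ · λ^{-A} · L_λ(g)` (IDEAS-prolate §100.2). -/
@[conjecture] def ProlateDominationWith (κ A lam₀ : ℝ) : Prop :=
  ∀ lam : ℝ, lam₀ ≤ lam → ∀ g : ℝ → ℂ, IsWeilTest g →
    tsupport g ⊆ Set.Icc (-Real.log lam) (Real.log lam) →
      κ * lam ^ (-A) * prolateLeakage lam g ≤ (weilQuadratic g).re

/-- ★ CONJECTURE (PL) — PROLATE DOMINATION (IDEAS-prolate §100.2): the semilocal Weil form is
uniformly elliptic with respect to prolate leakage, with at most polynomial loss in `λ`.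
OPEN; `riemannHypothesis_of_prolateDomination` shows it implies RH; `RH → (PL)` is unknown. -/
@[conjecture] def ProlateDomination : Prop :=
  ∃ κ A lam₀ : ℝ, 0 < κ ∧ 0 ≤ A ∧ 1 ≤ lam₀ ∧ ProlateDominationWith κ A lam₀

/-- The leakage is non-negative. -/
theorem leakage_nonneg (lam : ℝ) (f : ℝ → ℂ) : 0 ≤ LatticeUncertainty.leakage lam f :=
  integral_nonneg fun _ ↦ by positivity

/-- `0 ≤ L_λ(g)`. -/
theorem prolateLeakage_nonneg (lam : ℝ) (g : ℝ → ℂ) : 0 ≤ prolateLeakage lam g := by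
  refine Real.sInf_nonneg ?_
  rintro x ⟨f, -, rfl⟩
  exact leakage_nonneg lam f

/-- The window map of `0` is `0`. -/
@[simp] theorem windowMap_zero (lam t : ℝ) : windowMap lam 0 t = 0 := by
  simp [windowMap]

/-- Sanity: the zero function is a preimage of the zero test. -/
theorem zero_mem_fibre_zero (lam : ℝ) : (0 : ℝ → ℂ) ∈ fibre lam 0 := by
  refine ⟨contDiff_const, fun _ ↦ rfl, ?_, fun t _ ↦ by simp⟩
  have h : tsupport (0 : ℝ → ℂ) = ∅ := (tsupport_eq_empty_iff).2 rfl
  exact h.subset.trans (empty_subset _)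

/-- `L_λ(0) ≤ leakage λ 0` when the zero function lies in the fibre of `0`. -/
theorem prolateLeakage_zero_eq (lam : ℝ) (h : (0 : ℝ → ℂ) ∈ fibre lam 0) :
    prolateLeakage lam 0 ≤ LatticeUncertainty.leakage lam 0 := by
  refine csInf_le ?_ ⟨0, h, rfl⟩
  exact ⟨0, by rintro x ⟨f, -, rfl⟩; exact leakage_nonneg lam f⟩

/-- (PL) at level `λ` (with `κ ≥ 0`, `λ > 0`) gives Weil positivity on the window `[-log λ, log λ]`:
`Re Q(g) ≥ κ λ^{-A} L_λ(g) ≥ 0`. -/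
theorem weilPositivityOn_of_prolateDominationWith {κ A lam₀ lam : ℝ}
    (h : ProlateDominationWith κ A lam₀) (hκ : 0 ≤ κ) (hlam : lam₀ ≤ lam) (hpos : 0 < lam) :
    WeilPositivityOn (Real.log lam) := by
  intro g hg hsupp
  have h1 := h lam hlam g hg hsupp
  have h2 : 0 ≤ κ * lam ^ (-A) * prolateLeakage lam g :=
    mul_nonneg (mul_nonneg hκ (Real.rpow_nonneg hpos.le _)) (prolateLeakage_nonneg lam g)
  linarith

/-- ★ `(PL) → RH` (IDEAS-prolate §100.3 (a)): (PL) gives `WeilPositivityOn (log λ)` for every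
`λ ≥ λ₀`, the windows `log λ` exhaust `(0, ∞)` (`WeilPositivityOn.mono`), and
`RH ↔ ∀ a > 0, WeilPositivityOn a` is the tree's unconditional Weil–Yoshida criterion
(`riemannHypothesis_iff_forall_weilPositivityOn`). No «Base» conjunct is needed. -/
theorem riemannHypothesis_of_prolateDomination (h : ProlateDomination) : RiemannHypothesis := by
  obtain ⟨κ, A, lam₀, hκ, -, h1, h⟩ := h
  refine riemannHypothesis_iff_forall_weilPositivityOn.2 fun a _ ↦ ?_
  set lam : ℝ := max lam₀ (Real.exp a) with hlam
  have hpos : 0 < lam := lt_of_lt_of_le (Real.exp_pos a) (le_max_right _ _)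
  have hW : WeilPositivityOn (Real.log lam) :=
    weilPositivityOn_of_prolateDominationWith h hκ.le (le_max_left _ _) hpos
  refine hW.mono ?_
  calc a = Real.log (Real.exp a) := (Real.log_exp a).symm
    _ ≤ Real.log lam := Real.log_le_log (Real.exp_pos a) (le_max_right _ _)

/-- The same with the constants exposed. -/
theorem riemannHypothesis_of_prolateDominationWith {κ A lam₀ : ℝ} (hκ : 0 ≤ κ) (h0 : 0 < lam₀)
    (h : ProlateDominationWith κ A lam₀) : RiemannHypothesis := by
  refine riemannHypothesis_iff_forall_weilPositivityOn.2 fun a _ ↦ ?_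
  have hpos : 0 < max lam₀ (Real.exp a) := lt_of_lt_of_le h0 (le_max_left _ _)
  have hW : WeilPositivityOn (Real.log (max lam₀ (Real.exp a))) :=
    weilPositivityOn_of_prolateDominationWith h hκ (le_max_left _ _) hpos
  refine hW.mono ?_
  calc a = Real.log (Real.exp a) := (Real.log_exp a).symm
    _ ≤ Real.log (max lam₀ (Real.exp a)) := Real.log_le_log (Real.exp_pos a) (le_max_right _ _)

/-! Axiom census (expected: `propext`, `Classical.choice`, `Quot.sound` only). -/
#print axioms riemannHypothesis_of_prolateDomination

end Prolate

end Summit.RiemannHypothesis.RiemannHypothesis.Theorems
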